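import Literature.Geometry.Lorentzian.KerrSliceNormalRigidity
import Literature.Geometry.Lorentzian.KerrHyperboloidalLeaves
import Literature.Geometry.Lorentzian.LeviCivitaProofs
import HarnessLib

/-!
# `KerrShieldedDataExist`, line `plug-the-second-sheet` — the assembly, III: the Kerr–Schild zone

Support file (everything proved; no definitions, no named facts) for stub `stub_assembly` of crux
`stmt-FinalStateConjecture-10055`. On the zone `{7M/10 < |y| < 4M}` the glued datum is the datum of the
Kerr–Schild slice `{t* = 0}` of Schwarzschild, `(h, k) = (Kerr.hRep M, Kerr.kRep M)` (Cook 2000, (55), (57)).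
Here it is produced, on any chart domain `Kerr.slice 0 r₀`, as the datum INDUCED on the slice embedding
`y ↦ (0, y)` with its future unit normal `Kerr.sliceNormalRep M` — so that it solves the vacuum constraints by
the induced-vacuum-data packaging (hypothesis `hInd`, the landed `stub_inducedVacuumData` fed with the
Ricci-flatness of the chart) — WITHOUT the tree's instance hypothesis `[Kerr.SliceFacts]` of `Kerr.data`:

* `contDiffAt_sliceNormalRep`, `isSpacelikeImmersion_sliceEmbed_zero`, `isUnitNormal_sliceNormal_zero` — the
  hypotheses of the packaging for the slice (`h = hRep` is positive definite; `g(N, (0, w)) = 0`, `g(N, N) = −1`);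
* `exists_ksZoneData` — a vacuum initial data set on `Kerr.slice 0 r₀` with `h = hRep M`, `k = kRep M`
  (`Kerr.bilin_zero_ofTimeSpace`; `Kerr.secondFundamentalForm_eq_kRep_of_repr`).

References: Cook, Living Rev. Relativ. 3 (2000) 5, §3.2.2; O'Neill 1983, Ch. 4, Lemma 4.4.
-/

-- the doubled `FinalStateConjecture` path component is the summit/problem naming scheme, not a mistake
set_option linter.dupNamespace false

noncomputable section

open Set Filter Topology TopologicalSpace
open scoped Manifold ContDiff Topology InnerProductSpace
open Literature.Geometry.Lorentzian

namespace Summit.FinalStateConjecture.FinalStateConjecture.Theorems.SwallowTheDatum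

namespace Assembly

section KSZone

variable {M r₀ : ℝ}

/-- **The unit normal of the Schwarzschild slice is `C^n` off the axis** (`M ≥ 0`): `N = (1 + 2H)^{-1/2} V` with
`H`, `V` analytic off the axis and `1 + 2H > 0` (the tree's `Kerr.differentiableAt_sliceNormalRep` in every
degree). [cite: Cook2000, §3.2.2] -/
theorem contDiffAt_sliceNormalRep (hM : 0 ≤ M) {y : E3} (hy : y ≠ 0) {n : ℕ∞ω} :
    ContDiffAt ℝ n (Kerr.sliceNormalRep M) y := by
  have hx : 0 < Kerr.radius 0 (E4.ofTimeSpace 0 y) := by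
    rw [Kerr.radius_zero_ofTimeSpace]; exact norm_pos_iff.2 hy
  have he : ContDiff ℝ n (E4.ofTimeSpace 0) := E4.contDiff_ofTimeSpace 0
  have hH : ContDiffAt ℝ n (fun y : E3 ↦ Kerr.scalarH M 0 (E4.ofTimeSpace 0 y)) y :=
    (Kerr.contDiffAt_scalarH M 0 hx).comp y he.contDiffAt
  have hV : ContDiffAt ℝ n (fun y : E3 ↦ Kerr.timeVector M 0 (E4.ofTimeSpace 0 y)) y :=
    (Kerr.contDiffAt_timeVector M 0 hx).comp y he.contDiffAt
  have hpos : 0 < 1 + 2 * Kerr.scalarH M 0 (E4.ofTimeSpace 0 y) := by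
    have := Kerr.scalarH_nonneg hM 0 (E4.ofTimeSpace 0 y); positivity
  have hs : ContDiffAt ℝ n (fun y : E3 ↦ (√(1 + 2 * Kerr.scalarH M 0 (E4.ofTimeSpace 0 y)))⁻¹) y :=
    ((contDiffAt_const.add (contDiffAt_const.mul hH)).sqrt hpos.ne').inv (Real.sqrt_pos.2 hpos).ne'
  exact hs.smul hV

/-- The unit normal of the Schwarzschild slice is `C^∞` on every slice `Kerr.slice 0 r₀`. [cite: Cook2000, §3.2.2] -/
theorem contDiffOn_sliceNormalRep (hM : 0 ≤ M) (r₀ : ℝ) :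
    ContDiffOn ℝ ∞ (Kerr.sliceNormalRep M) (Kerr.slice 0 r₀ : Set E3) := fun y hy ↦
  (contDiffAt_sliceNormalRep hM (Kerr.ne_zero_of_mem_slice_zero ⟨y, hy⟩)).contDiffWithinAt

variable [Kerr.Facts]

/-- **The Kerr–Schild slice `y ↦ (0, y)` is a spacelike immersion** into the Schwarzschild chart (`M ≥ 0`): its
induced form is `hRep M y (v, v) = |v|² + (2M/|y|³)⟪y, v⟫² > 0` (Cook 2000, (55)); the tree's named fact
`Kerr.isSpacelikeImmersion_sliceEmbed` at `a = 0`. [cite: Cook2000, §3.2.2 (55)] -/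
theorem isSpacelikeImmersion_sliceEmbed_zero (hM : 0 ≤ M) (r₀ : ℝ) :
    (Kerr.smoothMetric M 0 r₀).IsSpacelikeImmersion 𝓘(ℝ, E3) (Kerr.sliceEmbed 0 r₀) := by
  refine ⟨Kerr.contMDiff_sliceEmbed 0 r₀ _, fun y (v : E3) hv ↦ ?_⟩
  have hy : (y : E3) ≠ 0 := Kerr.ne_zero_of_mem_slice_zero y
  rw [PseudoRiemannianMetric.inducedBilin_apply, Kerr.mfderiv_sliceEmbed_apply]
  have h1 : 0 < ‖v‖ := norm_pos_iff.2 hv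
  have h2 : 0 ≤ 2 * M / ‖(y : E3)‖ ^ 3 * (⟪(y : E3), v⟫_ℝ * ⟪(y : E3), v⟫_ℝ) := by
    have := mul_self_nonneg ⟪(y : E3), v⟫_ℝ
    positivity
  have hgoal : 0 < Kerr.bilin M 0 (E4.ofTimeSpace 0 (y : E3)) (E4.ofTimeSpace 0 v) (E4.ofTimeSpace 0 v) := by
    rw [Kerr.bilin_zero_ofTimeSpace M hy, Kerr.hRep_apply, real_inner_self_eq_norm_sq]
    positivity
  exact hgoal

/-- **`Kerr.sliceNormal M 0 r₀` is a unit normal of sign `−1` of the slice**: `g(N, (0, w)) = 0`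
(`Kerr.bilin_sliceNormalRep_ofTimeSpace`) and `g(N, N) = (1 + 2H)⁻¹ g(V, V) = −1`. [cite: Cook2000, §3.2.2] -/
theorem isUnitNormal_sliceNormal_zero (hM : 0 ≤ M) (r₀ : ℝ) :
    (Kerr.smoothMetric M 0 r₀).IsUnitNormal 𝓘(ℝ, E3) (Kerr.sliceEmbed 0 r₀) (Kerr.sliceNormal M 0 r₀) (-1) := by
  refine ⟨fun y v ↦ ?_, fun y ↦ ?_⟩
  · have hy : (y : E3) ≠ 0 := Kerr.ne_zero_of_mem_slice_zero y
    rw [Kerr.mfderiv_sliceEmbed_apply]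
    exact Kerr.bilin_sliceNormalRep_ofTimeSpace M hy v
  · have hx : 0 < Kerr.radius 0 (E4.ofTimeSpace 0 (y : E3)) := by
      rw [Kerr.radius_zero_ofTimeSpace]; exact Kerr.norm_pos_of_mem_slice_zero y
    set A := 1 + 2 * Kerr.scalarH M 0 (E4.ofTimeSpace 0 (y : E3)) with hA
    have hA0 : 0 < A := by have := Kerr.scalarH_nonneg hM 0 (E4.ofTimeSpace 0 (y : E3)); positivity
    have hs : (√A)⁻¹ * (√A)⁻¹ = A⁻¹ := by rw [← mul_inv, Real.mul_self_sqrt hA0.le]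
    have key : Kerr.bilin M 0 (E4.ofTimeSpace 0 (y : E3)) (Kerr.sliceNormalRep M y) (Kerr.sliceNormalRep M y) = -1 := by
      rw [Kerr.sliceNormalRep]
      simp only [map_smul, FunLike.coe_smul, Pi.smul_apply, smul_eq_mul,
        Kerr.bilin_timeVector_timeVector hx]
      rw [← hA]
      calc (√A)⁻¹ * ((√A)⁻¹ * (-1 - 2 * Kerr.scalarH M 0 (E4.ofTimeSpace 0 (y : E3))))
          = -((√A)⁻¹ * (√A)⁻¹ * A) := by rw [hA]; ring
        _ = -1 := by rw [hs, inv_mul_cancel₀ hA0.ne']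
    exact key

/-- **The Kerr–Schild zone datum.** For `M ≥ 0` and any `r₀`, given the induced-vacuum-data packaging `hInd`
for the chart `(Kerr.region 0 r₀, g_{M,0})` (the landed `stub_inducedVacuumData` fed with the Ricci-flatness of
the chart), there is a VACUUM initial data set on `Kerr.slice 0 r₀` whose sections are Cook's closed forms
`h = hRep M` ((55): the induced metric of `y ↦ (0, y)`, `Kerr.bilin_zero_ofTimeSpace`) and `k = kRep M` ((57): its
second fundamental form w.r.t. the future unit normal, `Kerr.secondFundamentalForm_eq_kRep_of_repr`).
[cite: Cook2000, §3.2.2 (55), (57)] -/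
theorem exists_ksZoneData (hM : 0 ≤ M) (r₀ : ℝ)
    (hInd : ∀ (U : Opens E3) (Φ N : E3 → E4) (f : U → Kerr.region 0 r₀) (ν : NormalField 𝓘(ℝ, E4) f),
      (∀ y : U, ((f y : Kerr.region 0 r₀) : E4) = Φ y) → (∀ y : U, ν y = N y) →
      ContDiffOn ℝ ∞ Φ (U : Set E3) → ContDiffOn ℝ ∞ N (U : Set E3) →
      (Kerr.smoothMetric M 0 r₀).IsSpacelikeImmersion 𝓘(ℝ, E3) f →
      (Kerr.smoothMetric M 0 r₀).IsUnitNormal 𝓘(ℝ, E3) f ν (-1) →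
      ∃ D : InitialDataSet 𝓘(ℝ, E3) U,
        (∀ y : U, D.h.inner y = (Kerr.smoothMetric M 0 r₀).inducedBilin 𝓘(ℝ, E3) f y) ∧
        (∀ [(Kerr.smoothMetric M 0 r₀).HasLeviCivita] (y : U),
          (D.k y).toLinearMap₁₂ = (Kerr.smoothMetric M 0 r₀).secondFundamentalForm 𝓘(ℝ, E3) f ν y) ∧
        (∀ [D.metric.HasLeviCivita], D.IsVacuumConstraintSolution)) :
    ∃ DK : InitialDataSet 𝓘(ℝ, E3) (Kerr.slice 0 r₀),
      (∀ [DK.metric.HasLeviCivita], DK.IsVacuumConstraintSolution) ∧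
      ∀ (y : Kerr.slice 0 r₀) (v w : E3),
        DK.h.inner y v w = Kerr.hRep M y v w ∧ DK.k y v w = Kerr.kRep M y v w := by
  have hf : ∀ y : Kerr.slice 0 r₀, ((Kerr.sliceEmbed 0 r₀ y : Kerr.region 0 r₀) : E4) = E4.ofTimeSpace 0 y :=
    fun _ ↦ rfl
  obtain ⟨D, hDh, hDk, hDvac⟩ := hInd (Kerr.slice 0 r₀) (E4.ofTimeSpace 0) (Kerr.sliceNormalRep M)
    (Kerr.sliceEmbed 0 r₀) (Kerr.sliceNormal M 0 r₀) hf (Kerr.sliceNormal_zero_eq M r₀)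
    (E4.contDiff_ofTimeSpace 0).contDiffOn (contDiffOn_sliceNormalRep hM r₀)
    (isSpacelikeImmersion_sliceEmbed_zero hM r₀) (isUnitNormal_sliceNormal_zero hM r₀)
  haveI : (Kerr.smoothMetric M 0 r₀).HasLeviCivita :=
    PseudoRiemannianMetric.hasLeviCivita (Kerr.smoothMetric M 0 r₀).toPseudoRiemannianMetric
  refine ⟨D, hDvac, fun y v w ↦ ⟨?_, ?_⟩⟩
  · have hy : (y : E3) ≠ 0 := Kerr.ne_zero_of_mem_slice_zero y
    rw [hDh y, PseudoRiemannianMetric.inducedBilin_apply, Kerr.smoothMetric_val, Kerr.mfderiv_sliceEmbed_apply,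
      Kerr.mfderiv_sliceEmbed_apply, Kerr.coe_sliceEmbed]
    exact Kerr.bilin_zero_ofTimeSpace M hy v w
  · have hy : (y : E3) ≠ 0 := Kerr.ne_zero_of_mem_slice_zero y
    have hk : D.k y v w = (Kerr.smoothMetric M 0 r₀).secondFundamentalForm 𝓘(ℝ, E3) (Kerr.sliceEmbed 0 r₀)
        (Kerr.sliceNormal M 0 r₀) y v w :=
      congrArg (fun B : LinearMap.BilinForm ℝ E3 ↦ B v w) (hDk y)
    rw [hk]
    exact Kerr.secondFundamentalForm_eq_kRep_of_repr hM hf (Kerr.sliceNormal_zero_eq M r₀)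
      (Kerr.hasFDerivAt_ofTimeSpace_zero _).differentiableAt (Kerr.differentiableAt_sliceNormalRep hM hy) rfl
      (fun v ↦ Kerr.fderiv_ofTimeSpace_zero _ v) rfl rfl v w

end KSZone

end Assembly

/-- **Registered export of this file** (sub-goal `assembly_ksZone` of stub `stub_assembly`): the Kerr–Schild zone
datum `(hRep, kRep)` as induced vacuum data, `Assembly.exists_ksZoneData`. [cite: Cook2000, §3.2.2 (55), (57)] -/
theorem assembly_ksZone :
    ∀ [Kerr.Facts] (M r₀ : ℝ), 0 ≤ M → (∀ (U : TopologicalSpace.Opens E3) (Φ N : E3 → E4) (f : U → Kerr.region 0 r₀) (ν : NormalField 𝓘(ℝ, E4) f), (∀ y : U, ((f y : Kerr.region 0 r₀) : E4) = Φ y) → (∀ y : U, ν y = N y) → ContDiffOn ℝ ∞ Φ (U : Set E3) → ContDiffOn ℝ ∞ N (U : Set E3) → (Kerr.smoothMetric M 0 r₀).IsSpacelikeImmersion 𝓘(ℝ, E3) f → (Kerr.smoothMetric M 0 r₀).IsUnitNormal 𝓘(ℝ, E3) f ν (-1) → ∃ D : InitialDataSet 𝓘(ℝ, E3) U, (∀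 y : U, D.h.inner y = (Kerr.smoothMetric M 0 r₀).inducedBilin 𝓘(ℝ, E3) f y) ∧ (∀ [(Kerr.smoothMetric M 0 r₀).HasLeviCivita] (y : U), (D.k y).toLinearMap₁₂ = (Kerr.smoothMetric M 0 r₀).secondFundamentalForm 𝓘(ℝ, E3) f ν y) ∧ (∀ [D.metric.HasLeviCivita], D.IsVacuumConstraintSolution)) → ∃ DK : InitialDataSet 𝓘(ℝ, E3) (Kerr.slice 0 r₀), (∀ [DK.metric.HasLeviCivita], DK.IsVacuumConstraintSolution) ∧ ∀ (y : Kerr.slice 0 r₀) (v w : E3), DK.h.inner y v w = Kerr.hRep M y v w ∧ DK.k y v w = Kerr.kRep M y v w :=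
  fun _ _ hM hInd ↦ Assembly.exists_ksZoneData hM _ hInd

end Summit.FinalStateConjecture.FinalStateConjecture.Theorems.SwallowTheDatum

end
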